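import Literature.AnabelianGeometry.EtaleTheta.TemperedFrobenioidCor38Sub
import Literature.AnabelianGeometry.EtaleTheta.Discharge.Sec3CuspidalPreSteps

/-!
# [EtTh] Remark 3.6.3, OBJECT clause — row C38-L10a of the Cor. 3.8 sub-DAG, PROVED

Mochizuki, *The étale theta function …*, Publ. RIMS **45** (2009), Rmk. 3.6.3, PDF pp. 78–79: "the objects of the
essential image of the natural functor `C^bs-fld → C` may be described as the objects of `C` that may be 'linked'
to a Frobenius-trivial object via base-field theoretic pre-steps" [cite: MochizukiEtTh2009, Rmk 3.6.3 p.79] —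
used in the proof of Cor. 3.8 (ii), p.82. abc-iut cell, layer L2, seat abc-iut-w5-d124; proof-only companion
(no public definitions) of `TemperedFrobenioidCor38Sub.lean` (p414329; plan/L2/SUBDAG-EtTh-Cor38.md), discharging
its row **C38-L10a** `TemperedFrobenioid.HullEssImageObjClause` for every tempered Frobenioid over the tree
vocabulary `treeMonoidVocab` (the setting of abc-iut-L2-d2's `Discharge/Sec3CuspidalPreSteps.lean`, whose
`objectwise_isGroupLike` / `objectwise_isDivisorial` are used): `hullEssImageObjClause_holds`, UNCONDITIONAL.
Route ("the explicit divisorial description of objects and morphisms of a model Frobenioid", [FrdI] Thm. 5.2 (i)):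
LEMMA `essImageObj_hull_iff` — `(A_D, α)` lies in the essential image iff `α = ι(ξ) · Div_B(u)` for a class `ξ`
of `(Φ^{bs-fld})^gp(A_D)` and a rational function `u`; `(A_D, 0)` is Frobenius-trivial (`isFrobeniusTrivial_one`);
Frobenius-trivial objects satisfy `α = Div_B(u)` (`essImageObj_hull_of_isFrobeniusTrivial`); the description is
stable under base-field-theoretic pre-steps in both directions (`essImageObj_hull_of_preStep`, `…'`); and every
object of the essential image is reached from `(A_D, 0)` by the zigzag `(A_D,0) → (A_D,x) ← (A_D,x−y) → (A_D,α)`.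
HONEST FRAMING: refereed pre-IUT material; nothing here bears on [IUTchIII] Cor. 3.12.
-/

namespace Literature.AnabelianGeometry.EtaleTheta

open CategoryTheory Opposite Literature.AlgebraicGeometry.Frobenioids

universe u₀ v₀ u v w

variable {D₀ : Type u₀} [Category.{v₀} D₀] {T : RealifiedDivisorMonoids (D₀ := D₀) treeMonoidVocab.{w}}
  {D : Type u} [Category.{v} D] {VD : FrdICatStub.{u, v, w} D}

namespace TemperedFrobenioid

variable (C : TemperedFrobenioid T D VD)

/-- Every element of a Grothendieck group `M^gp` is a fraction of elements of `M`. [folklore] -/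
private theorem gp_exists_eq_div' {M : Type*} [CommMonoid M] (x : Algebra.GrothendieckGroup M) :
    ∃ a b : M, x = Algebra.GrothendieckGroup.of a / Algebra.GrothendieckGroup.of b := by
  obtain ⟨⟨a, b⟩, h⟩ := (Localization.monoidOf (⊤ : Submonoid M)).surj x
  exact ⟨a, b, eq_div_iff_mul_eq'.mpr h⟩

/-- **Rmk. 3.6.3, object clause — LEMMA E**: an object `(A_D, α)` of `C` lies in the essential image of
`C^{bs-fld} → C` iff its class is the image of a class of `(Φ^{bs-fld})^gp(A_D)` times `Div_B` of a rational
function ("the explicit divisorial description of objects … of a model Frobenioid", [FrdI] Thm. 5.2 (i)).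
[cite: MochizukiEtTh2009, Rmk 3.6.3 p.79] -/
theorem essImageObj_hull_iff (A : C.category) :
    essImageObj C.hull A ↔
      ∃ (ξ : Algebra.GrothendieckGroup (C.bsFldMonoid.obj (op A.base))) (u : C.ratFnFunctor.obj (op A.base)),
        A.cls = C.bsFldInclGpM _ ξ *
          Literature.AlgebraicGeometry.Frobenioids.divB C.divisorMonoid C.ratFnFunctor C.divBNatTrans (op A.base) u := by
  constructor
  · rintro ⟨X, ⟨e⟩⟩
    haveI : IsIso (ModelFrobenioid.baseMap e.inv) := ModelFrobenioid.isIso_baseMap_of_isIso e.inv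
    have hrel := ModelFrobenioid.rel e.inv
    rw [ModelFrobenioid.degFr_eq_one_of_isIso e.inv, PNat.one_coe, pow_one,
      ModelFrobenioid.div_eq_one_of_isIso C.objectwise_isDivisorial e.inv, map_one, mul_one] at hrel
    refine ⟨pullGp C.bsFldMonoid (ModelFrobenioid.baseMap e.inv) X.cls, ModelFrobenioid.unit e.inv, ?_⟩
    rw [bsFldInclGpM_pullGp]
    exact hrel
  · rintro ⟨ξ, u, hA⟩
    obtain ⟨uu, huu⟩ := (C.objectwise_isGroupLike A.base).isUnit u
    let X : C.hullCategory := ⟨A.base, ξ⟩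
    let φ : C.hull.obj X ⟶ A :=
      ModelFrobenioid.mkHom (C.hull.obj X) A 1 (𝟙 A.base) 1 (↑uu⁻¹ : C.ratFnFunctor.obj (op A.base)) (by
        change (C.bsFldInclGpM (op A.base) ξ) ^ ((1 : ℕ+) : ℕ) *
            Algebra.GrothendieckGroup.of (1 : C.divisorMonoid.obj (op A.base)) =
          pullGp C.divisorMonoid (𝟙 A.base) A.cls *
            Literature.AlgebraicGeometry.Frobenioids.divB C.divisorMonoid C.ratFnFunctor C.divBNatTrans (op A.base) (↑uu⁻¹)
        rw [PNat.one_coe, pow_one, map_one, mul_one, pullGp_id, hA, mul_assoc, ← map_mul, ← huu,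
          Units.mul_inv, map_one, mul_one])
    haveI : IsIso (ModelFrobenioid.baseMap φ) := (inferInstance : IsIso (𝟙 A.base))
    haveI : IsIso φ := ModelFrobenioid.isIso_of C.objectwise_isGroupLike φ rfl rfl
    exact ⟨X, ⟨asIso φ⟩⟩

/-- A morphism with `deg_Fr = 1` and `Base` an isomorphism is a pre-step (operations language). (bookkeeping)
[cite: MochizukiFrdI2008, Def. 1.2 (iii) p.22] -/
private theorem isPreStep_mkHom_one {X Y : C.category} (f : X.base ⟶ Y.base) [IsIso f]
    (x : C.divisorMonoid.obj (op X.base)) (u : C.ratFnFunctor.obj (op X.base)) (h) :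
    C.opsData.IsPreStep (ModelFrobenioid.mkHom X Y 1 f x u h) :=
  ⟨rfl, (show IsIso f from inferInstance)⟩

/-- `(A_D, 1)` is Frobenius-trivial: `n ↦ (n, id, 0, 0)` is a section of the Frobenius degree by base-identity
morphisms of Frobenius type. [cite: MochizukiFrdI2008, Thm. 5.2(ii) p.101] -/
theorem isFrobeniusTrivial_one (a : D) :
    C.opsData.IsFrobeniusTrivial (⟨a, 1⟩ : C.category) := by
  let A₀ : C.category := ⟨a, 1⟩
  have hrel : ∀ n : ℕ+, A₀.cls ^ (n : ℕ) * Algebra.GrothendieckGroup.of (1 : C.divisorMonoid.obj (op a)) =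
      pullGp C.divisorMonoid (𝟙 a) A₀.cls *
        Literature.AlgebraicGeometry.Frobenioids.divB C.divisorMonoid C.ratFnFunctor C.divBNatTrans (op a) 1 := by
    intro n
    change (1 : Algebra.GrothendieckGroup _) ^ (n : ℕ) * _ = pullGp C.divisorMonoid (𝟙 a) 1 * _
    rw [one_pow, map_one, pullGp_id, map_one, one_mul]
  let ζ : ℕ+ →* End A₀ :=
    { toFun := fun n => ModelFrobenioid.mkHom A₀ A₀ n (𝟙 a) 1 1 (hrel n)
      map_one' := ModelFrobenioid.hom_ext rfl rfl rfl rfl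
      map_mul' := fun m n => by
        apply ModelFrobenioid.hom_ext
        · rfl
        · exact (Category.comp_id _).symm
        · change (1 : C.divisorMonoid.obj (op a)) = pull C.divisorMonoid (𝟙 a) 1 * 1 ^ ((m : ℕ+) : ℕ)
          rw [map_one, one_pow, one_mul]
        · change (1 : C.ratFnFunctor.obj (op a)) = pull C.ratFnFunctor (𝟙 a) 1 * 1 ^ ((m : ℕ+) : ℕ)
          rw [map_one, one_pow, one_mul] }
  refine ⟨ζ, fun n => ⟨rfl, rfl, ?_⟩⟩
  refine (PreFrobenioidData.ofFunctor_isFrobeniusType C.toElem _).2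
    ⟨⟨ModelFrobenioid.isCoAngular C.objectwise_isGroupLike _, rfl⟩, ?_⟩
  exact (inferInstance : IsIso (𝟙 a))

/-- Frobenius-trivial objects lie in the essential image of the hull (from `ζ 2`: `α² = α · Div_B(u)`).
[cite: MochizukiEtTh2009, Rmk 3.6.3 p.79] -/
theorem essImageObj_hull_of_isFrobeniusTrivial (A : C.category) (hA : C.opsData.IsFrobeniusTrivial A) :
    essImageObj C.hull A := by
  obtain ⟨ζ, hζ⟩ := hA
  obtain ⟨hdeg, hbase, hfrob⟩ := hζ 2
  have hfrob' := (PreFrobenioidData.ofFunctor_isFrobeniusType C.toElem _).1 hfrob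
  have hdiv : ModelFrobenioid.div (ζ 2) = 1 := hfrob'.1.2
  have hb : ModelFrobenioid.baseMap (ζ 2) = 𝟙 _ := hbase
  have hd : ModelFrobenioid.degFr (ζ 2) = 2 := hdeg
  have hrel := ModelFrobenioid.rel (ζ 2)
  rw [hd, hdiv, hb, map_one, mul_one, pullGp_id] at hrel
  -- `hrel : A.cls ^ 2 = A.cls * Div_B(u)`
  refine (C.essImageObj_hull_iff A).2 ⟨1, ModelFrobenioid.unit (ζ 2), ?_⟩
  rw [map_one, one_mul]
  have h2 : A.cls * A.cls = A.cls *
      Literature.AlgebraicGeometry.Frobenioids.divB C.divisorMonoid C.ratFnFunctor C.divBNatTrans (op A.base)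
        (ModelFrobenioid.unit (ζ 2)) := by
    rw [← pow_two]
    exact hrel
  exact mul_left_cancel h2

/-- The class description of the essential image is stable under base-field-theoretic pre-steps, forward.
[cite: MochizukiEtTh2009, Rmk 3.6.3 p.79] -/
theorem essImageObj_hull_of_preStep {X Y : C.category} (φ : X ⟶ Y) (hφ : C.opsData.IsPreStep φ)
    (hbs : C.IsBaseFieldTheoretic φ) (hX : essImageObj C.hull X) : essImageObj C.hull Y := by
  obtain ⟨ξ, u, hXcls⟩ := (C.essImageObj_hull_iff X).1 hX
  haveI : IsIso (ModelFrobenioid.baseMap φ) := hφ.2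
  have hd : ModelFrobenioid.degFr φ = 1 := hφ.1
  -- the zero divisor of `φ` as an element of `Φ^{bs-fld}`
  let x₀ : C.bsFldMonoid.obj (op X.base) := ⟨(ModelFrobenioid.div φ).1, hbs⟩
  have hx₀ : C.bsFldInclM _ x₀ = ModelFrobenioid.div φ := Subtype.ext rfl
  obtain ⟨vv, hvv⟩ := (C.objectwise_isGroupLike X.base).isUnit (ModelFrobenioid.unit φ)
  have hrel := ModelFrobenioid.rel φ
  rw [hd, PNat.one_coe, pow_one, hXcls, ← hx₀, ← bsFldInclGpM_of, ← hvv] at hrel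
  -- `hrel : ι ξ * Div_B u * ι(of x₀) = pullGp (Base φ) Y.cls * Div_B ↑vv`
  have hD : Literature.AlgebraicGeometry.Frobenioids.divB C.divisorMonoid C.ratFnFunctor C.divBNatTrans (op X.base) (↑vv : C.ratFnFunctor.obj (op X.base)) *
      Literature.AlgebraicGeometry.Frobenioids.divB C.divisorMonoid C.ratFnFunctor C.divBNatTrans (op X.base) (↑vv⁻¹ : C.ratFnFunctor.obj (op X.base)) = 1 := by
    rw [← map_mul, Units.mul_inv, map_one]
  have key : pullGp C.divisorMonoid (ModelFrobenioid.baseMap φ) Y.cls =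
      C.bsFldInclGpM _ (ξ * Algebra.GrothendieckGroup.of x₀) * Literature.AlgebraicGeometry.Frobenioids.divB C.divisorMonoid C.ratFnFunctor C.divBNatTrans (op X.base) (u * ↑vv⁻¹) := by
    calc pullGp C.divisorMonoid (ModelFrobenioid.baseMap φ) Y.cls
        = pullGp C.divisorMonoid (ModelFrobenioid.baseMap φ) Y.cls *
            (Literature.AlgebraicGeometry.Frobenioids.divB C.divisorMonoid C.ratFnFunctor C.divBNatTrans (op X.base) (↑vv : C.ratFnFunctor.obj (op X.base)) *
              Literature.AlgebraicGeometry.Frobenioids.divB C.divisorMonoid C.ratFnFunctor C.divBNatTrans (op X.base) (↑vv⁻¹ : C.ratFnFunctor.obj (op X.base))) := by rw [hD, mul_one]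
      _ = (C.bsFldInclGpM _ ξ * Literature.AlgebraicGeometry.Frobenioids.divB C.divisorMonoid C.ratFnFunctor C.divBNatTrans (op X.base) u * C.bsFldInclGpM _ (Algebra.GrothendieckGroup.of x₀)) *
            Literature.AlgebraicGeometry.Frobenioids.divB C.divisorMonoid C.ratFnFunctor C.divBNatTrans (op X.base) (↑vv⁻¹ : C.ratFnFunctor.obj (op X.base)) := by rw [← mul_assoc, ← hrel]
      _ = C.bsFldInclGpM _ (ξ * Algebra.GrothendieckGroup.of x₀) * Literature.AlgebraicGeometry.Frobenioids.divB C.divisorMonoid C.ratFnFunctor C.divBNatTrans (op X.base) (u * ↑vv⁻¹) := by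
            rw [map_mul, map_mul, mul_right_comm (C.bsFldInclGpM _ ξ), mul_assoc]
  refine (C.essImageObj_hull_iff Y).2
    ⟨pullGp C.bsFldMonoid (inv (ModelFrobenioid.baseMap φ)) (ξ * Algebra.GrothendieckGroup.of x₀),
      (C.ratFnFunctor.map (inv (ModelFrobenioid.baseMap φ)).op).hom (u * ↑vv⁻¹), ?_⟩
  rw [bsFldInclGpM_pullGp, ← pullGp_divB, ← map_mul, ← key, PreFrobenioid.pullGp_inv_pullGp]

/-- … and backward. [cite: MochizukiEtTh2009, Rmk 3.6.3 p.79] -/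
theorem essImageObj_hull_of_preStep' {X Y : C.category} (φ : X ⟶ Y) (hφ : C.opsData.IsPreStep φ)
    (hbs : C.IsBaseFieldTheoretic φ) (hY : essImageObj C.hull Y) : essImageObj C.hull X := by
  obtain ⟨η, v, hYcls⟩ := (C.essImageObj_hull_iff Y).1 hY
  haveI : IsIso (ModelFrobenioid.baseMap φ) := hφ.2
  have hd : ModelFrobenioid.degFr φ = 1 := hφ.1
  let x₀ : C.bsFldMonoid.obj (op X.base) := ⟨(ModelFrobenioid.div φ).1, hbs⟩
  have hx₀ : C.bsFldInclM _ x₀ = ModelFrobenioid.div φ := Subtype.ext rfl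
  have hrel := ModelFrobenioid.rel φ
  rw [hd, PNat.one_coe, pow_one, hYcls, ← hx₀, ← bsFldInclGpM_of, map_mul, ← bsFldInclGpM_pullGp,
    pullGp_divB] at hrel
  -- `hrel : X.cls * ι(of x₀) = ι(pullGp b η) * Div_B(B(b) v) * Div_B(unit φ)`
  refine (C.essImageObj_hull_iff X).2
    ⟨pullGp C.bsFldMonoid (ModelFrobenioid.baseMap φ) η * (Algebra.GrothendieckGroup.of x₀)⁻¹,
      (C.ratFnFunctor.map (ModelFrobenioid.baseMap φ).op).hom v * ModelFrobenioid.unit φ, ?_⟩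
  have hX : X.cls = (X.cls * C.bsFldInclGpM _ (Algebra.GrothendieckGroup.of x₀)) *
      (C.bsFldInclGpM _ (Algebra.GrothendieckGroup.of x₀))⁻¹ := by rw [mul_inv_cancel_right]
  rw [hX, hrel, map_mul, map_mul, map_inv]
  rw [mul_right_comm (C.bsFldInclGpM _ (pullGp C.bsFldMonoid (ModelFrobenioid.baseMap φ) η) * _) _
      (C.bsFldInclGpM _ (Algebra.GrothendieckGroup.of x₀))⁻¹,
    mul_right_comm (C.bsFldInclGpM _ (pullGp C.bsFldMonoid (ModelFrobenioid.baseMap φ) η)) _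
      (C.bsFldInclGpM _ (Algebra.GrothendieckGroup.of x₀))⁻¹,
    mul_assoc (C.bsFldInclGpM _ (pullGp C.bsFldMonoid (ModelFrobenioid.baseMap φ) η) *
      (C.bsFldInclGpM _ (Algebra.GrothendieckGroup.of x₀))⁻¹)]

/-- A `mkHom … 1 (𝟙 _) x u` whose zero divisor lies in `Φ^{bs-fld}` witnesses the linking relation.
(bookkeeping) [cite: MochizukiEtTh2009, Rmk 3.6.3 p.79] -/
private theorem linked_of_mkHom {X Y : C.category} (h : X.base = Y.base)
    (x : C.divisorMonoid.obj (op X.base)) (hx : C.IsBaseFieldTheoreticDiv x) (u : C.ratFnFunctor.obj (op X.base))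
    (hrel : X.cls ^ ((1 : ℕ+) : ℕ) * Algebra.GrothendieckGroup.of x =
      pullGp C.divisorMonoid (eqToHom h) Y.cls * Literature.AlgebraicGeometry.Frobenioids.divB C.divisorMonoid C.ratFnFunctor C.divBNatTrans (op X.base) u) :
    C.LinkedByBsFldPreSteps X Y :=
  Relation.EqvGen.rel _ _ ⟨ModelFrobenioid.mkHom X Y 1 (eqToHom h) x u hrel,
    isPreStep_mkHom_one C (eqToHom h) x u hrel, hx⟩

/-- **C38-L10a PROVED** ([EtTh] Rmk. 3.6.3, object clause): the objects of the essential image of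
`C^{bs-fld} → C` are exactly the objects linked to a Frobenius-trivial object by base-field-theoretic pre-steps.
[cite: MochizukiEtTh2009, Rmk 3.6.3 p.79] -/
theorem hullEssImageObjClause_holds : C.HullEssImageObjClause := by
  intro A
  constructor
  · intro hA
    obtain ⟨ξ, u, hA'⟩ := (C.essImageObj_hull_iff A).1 hA
    obtain ⟨x, y, hξ⟩ := gp_exists_eq_div' ξ
    obtain ⟨uu, huu⟩ := (C.objectwise_isGroupLike A.base).isUnit u
    let A₀ : C.category := ⟨A.base, 1⟩
    let A₁ : C.category := ⟨A.base, Algebra.GrothendieckGroup.of (C.bsFldInclM _ x)⟩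
    let A₂ : C.category := ⟨A.base, C.bsFldInclGpM _ ξ⟩
    refine ⟨A₀, C.isFrobeniusTrivial_one A.base, ?_⟩
    have h01 : C.LinkedByBsFldPreSteps A₀ A₁ := by
      refine linked_of_mkHom C (X := A₀) (Y := A₁) rfl (C.bsFldInclM _ x) x.2 1 ?_
      change (1 : Algebra.GrothendieckGroup _) ^ ((1 : ℕ+) : ℕ) * _ =
        pullGp C.divisorMonoid (𝟙 A.base) (Algebra.GrothendieckGroup.of (C.bsFldInclM _ x)) * _
      rw [one_pow, one_mul, map_one, mul_one]; exact (pullGp_id _ _).symm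
    have h21 : C.LinkedByBsFldPreSteps A₂ A₁ := by
      refine linked_of_mkHom C (X := A₂) (Y := A₁) rfl (C.bsFldInclM _ y) y.2 1 ?_
      change (C.bsFldInclGpM _ ξ) ^ ((1 : ℕ+) : ℕ) * _ =
        pullGp C.divisorMonoid (𝟙 A.base) (Algebra.GrothendieckGroup.of (C.bsFldInclM _ x)) * _
      rw [PNat.one_coe, pow_one, map_one, mul_one, ← bsFldInclGpM_of, ← map_mul, hξ, div_mul_cancel,
        bsFldInclGpM_of]
      exact (pullGp_id _ _).symm
    have h2A : C.LinkedByBsFldPreSteps A₂ A := by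
      refine linked_of_mkHom C (X := A₂) (Y := A) rfl 1 (C.bsFld.carrier _).one_mem
        (↑uu⁻¹ : C.ratFnFunctor.obj (op A.base)) ?_
      change (C.bsFldInclGpM _ ξ) ^ ((1 : ℕ+) : ℕ) * Algebra.GrothendieckGroup.of 1 =
        pullGp C.divisorMonoid (𝟙 A.base) A.cls * _
      rw [PNat.one_coe, pow_one, map_one, mul_one, pullGp_id, hA', mul_assoc, ← map_mul, ← huu,
        Units.mul_inv, map_one, mul_one]
    exact (h01.trans _ _ _ (h21.symm _ _)).trans _ _ _ h2A
  · rintro ⟨A₀, hA₀, hlink⟩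
    have key : ∀ X Y : C.category, C.LinkedByBsFldPreSteps X Y →
        (essImageObj C.hull X ↔ essImageObj C.hull Y) := by
      intro X Y hXY
      induction hXY with
      | rel X Y hXY =>
          obtain ⟨φ, hφ, hbs⟩ := hXY
          exact ⟨C.essImageObj_hull_of_preStep φ hφ hbs, C.essImageObj_hull_of_preStep' φ hφ hbs⟩
      | refl X => exact Iff.rfl
      | symm X Y _ ih => exact ih.symm
      | trans X Y Z _ _ ih₁ ih₂ => exact ih₁.trans ih₂
    exact (key _ _ hlink).1 (C.essImageObj_hull_of_isFrobeniusTrivial A₀ hA₀)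

end TemperedFrobenioid

end Literature.AnabelianGeometry.EtaleTheta
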